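import Literature.Analysis.FluidPDE.KNSSTypeIIZoomIn
import Literature.Analysis.FluidPDE.KNSSTypeIRateMildProofs
import Literature.Analysis.FluidPDE.KNSSTypeIRateLimit
import Literature.Analysis.FluidPDE.KNSSTypeIRateLiouvilleHolds
import Literature.Analysis.FluidPDE.AncientMildCompactness
import Literature.Analysis.FluidPDE.BoundedMildSmoothRemainder
import Literature.Analysis.FluidPDE.NSLerayOseenRepresentation
import Literature.Analysis.FluidPDE.NSBoundedMildOseenRestart
import Literature.Analysis.FluidPDE.NSBoundedMildSmoothing
import Literature.Analysis.FluidPDE.KNSSAxisymmetricNoSwirlHolds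
import Summits.NavierStokesRegularity.NavierStokesRegularity.Theorems.CertifiedBlowupCertifiedBlowupAxisymBlowupSwirlPersists
import Summits.NavierStokesRegularity.NavierStokesRegularity.Theorems.CertifiedBlowupCertifiedBlowupAxisymBlowupSwirlOrderParameter
import HarnessLib

/-!
# PROBE — axis-aware KNSS sup-zoom of a witness of `CertifiedBlowupAxisymBlowup` (stub signatures)
-/

set_option linter.dupNamespace false

noncomputable section

open MeasureTheory Set Function Filter Topology Metric
open scoped NNReal ENNReal

namespace Summit.NavierStokesRegularity.NavierStokesRegularity.Theorems.CertifiedBlowupAxisymBlowup.CompactAmplification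

open Literature.Analysis Literature.Analysis.FluidPDE
open Summit.NavierStokesRegularity.NavierStokesRegularity.Theses.CertifiedBlowup

local notation "ℝ³" => EuclideanSpace ℝ (Fin 3)

/-- stub Z2: near-maximum selection with a factor `γ > 1`. -/
theorem zoom_nearMax_gamma : ∀ {u : ℝ → ℝ³ → ℝ³} {T : ℝ},
    (∀ T' < T, ∃ M : ℝ, ∀ t ∈ Ioo 0 T', ∀ x, ‖u t x‖ ≤ M) →
    (¬ ∃ M : ℝ, ∀ t ∈ Ioo 0 T, ∀ x, ‖u t x‖ ≤ M) → ∀ (R γ : ℝ), 1 < γ →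
    ∃ t₀ ∈ Ioo 0 T, ∃ x₀ : ℝ³, R < ‖u t₀ x₀‖ ∧
      ∀ s ∈ Ioc 0 t₀, ∀ y, ‖u s y‖ ≤ γ * ‖u t₀ x₀‖ := by
  sorry

/-- stub Z1: the witness satisfies the Oseen integral identity, restarted, pointwise. -/
theorem zoom_oseen_of_witness : ∀ {T : ℝ} {u : ℝ → ℝ³ → ℝ³} {p : ℝ → ℝ³ → ℝ}, 0 < T →
    IsClassicalNSSolutionOn (Ico 0 T) 1 0 u p → IsLerayHopfOn T 1 0 (u 0) u →
    HasRapidSpatialDecay (u 0) → IsAxisymmetric (u 0) →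
    ∀ s t : ℝ, 0 ≤ s → s < t → t < T → ∀ x,
      u t x = UnboundedOperators.heatExtension (u s) (t - s) x - oseenDuhamel 1 s u u t x := by
  sorry

/-- stub Z3: uniform space–time Lipschitz modulus, up to the final time, of bounded Oseen-mild
continuous fields on a window. -/
theorem zoom_window_lipschitz : ∃ L : ℝ, 0 ≤ L ∧ ∀ (V : ℝ → ℝ³ → ℝ³) (A B : ℝ), A ≤ -3 → 0 < B →
    ContinuousOn (uncurry V) (Ioo A B ×ˢ univ) →
    (∀ s ∈ Ioc A 0, ∀ y, ‖V s y‖ ≤ 2) →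
    (∀ s ∈ Ioo A B, IsWeaklyDivFree (V s)) →
    (∀ s t : ℝ, A < s → s < t → t ≤ 0 → ∀ x,
      V t x = UnboundedOperators.heatExtension (V s) (t - s) x - oseenDuhamel 1 s V V t x) →
    ∀ s ∈ Icc (-1 : ℝ) 0, ∀ t ∈ Icc (-1 : ℝ) 0, ∀ x y : ℝ³,
      ‖V t x - V s y‖ ≤ L * (|t - s| + ‖x - y‖) := by
  sorry

/-- stub G0: extraction of the blow-up limit with non-triviality at the marked point. -/
theorem zoom_extract : ∀ (A B γ : ℕ → ℝ) (V : ℕ → ℝ → ℝ³ → ℝ³) (a : ℕ → ℝ³) (a₀ : ℝ³) (L : ℝ),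
    Tendsto A atTop atBot → (∀ n, A n ≤ -3) → (∀ n, 0 < B n) →
    (∀ n, ContinuousOn (uncurry (V n)) (Ioo (A n) (B n) ×ˢ univ)) →
    (∀ n, ∀ s ∈ Ioo (A n) (B n), IsWeaklyDivFree (V n s)) →
    (∀ n, ∀ s t : ℝ, A n < s → s < t → t ≤ 0 → ∀ x,
      V n t x = UnboundedOperators.heatExtension (V n s) (t - s) x -
        oseenDuhamel 1 s (V n) (V n) t x) →
    (∀ n, ∀ s ∈ Ioc (A n) 0, ∀ y, ‖V n s y‖ ≤ γ n) → (∀ n, γ n ≤ 2) →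
    Tendsto γ atTop (𝓝 1) →
    (∀ n, ‖V n 0 (a n)‖ = 1) → Tendsto a atTop (𝓝 a₀) → 0 ≤ L →
    (∀ n, ∀ s ∈ Icc (-1 : ℝ) 0, ∀ t ∈ Icc (-1 : ℝ) 0, ∀ x y : ℝ³,
      ‖V n t x - V n s y‖ ≤ L * (|t - s| + ‖x - y‖)) →
    ∃ (φ : ℕ → ℕ) (W : ℝ → ℝ³ → ℝ³), StrictMono φ ∧
      ContinuousOn (uncurry W) (Iio 0 ×ˢ univ) ∧
      (∀ t < 0, ∀ x, ‖W t x‖ ≤ 1) ∧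
      (∀ t < 0, IsWeaklyDivFree (W t)) ∧
      (∀ s t : ℝ, s < t → t < 0 → ∀ x,
        W t x = UnboundedOperators.heatExtension (W s) (t - s) x - oseenDuhamel 1 s W W t x) ∧
      (∀ s ∈ Ioo (-1 : ℝ) 0, 1 - L * |s| ≤ ‖W s a₀‖) ∧
      (∀ t < 0, ∀ x, Tendsto (fun j => V (φ j) t x) atTop (𝓝 (W t x))) ∧
      (∀ t < 0, TendstoLocallyUniformly (fun j => V (φ j) t) (W t) atTop) := by
  sorry

/-- stub G1: axisymmetry and a swirl bound pass to pointwise limits. -/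
theorem zoom_limit_axisymmetric : ∀ (V : ℕ → ℝ³ → ℝ³) (w : ℝ³ → ℝ³) (S : ℝ),
    (∀ n, IsAxisymmetric (V n)) → (∀ n y, |swirl (V n) y| ≤ S) →
    (∀ y, Tendsto (fun n => V n y) atTop (𝓝 (w y))) →
    IsAxisymmetric w ∧ ∀ y, |swirl w y| ≤ S := by
  sorry

/-- stub G2: a line-invariant bounded ancient Oseen-mild field with vanishing transversal
component is a constant (KNSS Thm 5.1 on the planar trace + Remark 6.1). -/
theorem zoom_limit_const : ∀ (W : ℝ → ℝ³ → ℝ³),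
    ContinuousOn (uncurry W) (Iio 0 ×ˢ univ) → (∃ K : ℝ, ∀ t < 0, ∀ x, ‖W t x‖ ≤ K) →
    (∀ t < 0, IsWeaklyDivFree (W t)) →
    (∀ s t : ℝ, s < t → t < 0 → ∀ x,
      W t x = UnboundedOperators.heatExtension (W s) (t - s) x - oseenDuhamel 1 s W W t x) →
    (∀ t < 0, ∀ (x : ℝ³) (δ : ℝ), W t (x + EuclideanSpace.single 1 δ) = W t x) →
    (∀ t < 0, ∀ x, W t x 1 = 0) →
    ∃ b : ℝ³, b 1 = 0 ∧ ∀ t < 0, ∀ x, W t x = b := by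
  sorry

/-- stub G3: an axisymmetric swirl-free bounded ancient Oseen-mild field is a constant multiple of
`e_z` (KNSS Thm 5.2 in the tree's mild class + Remark 6.1). -/
theorem zoom_noSwirl_const : ∀ (W : ℝ → ℝ³ → ℝ³),
    ContinuousOn (uncurry W) (Iio 0 ×ˢ univ) → (∃ K : ℝ, ∀ t < 0, ∀ x, ‖W t x‖ ≤ K) →
    (∀ t < 0, IsWeaklyDivFree (W t)) →
    (∀ s t : ℝ, s < t → t < 0 → ∀ x,
      W t x = UnboundedOperators.heatExtension (W s) (t - s) x - oseenDuhamel 1 s W W t x) →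
    (∀ t < 0, IsAxisymmetric (W t)) → (∀ t < 0, HasNoSwirl (W t)) →
    ∃ β : ℝ, ∀ t < 0, ∀ x, W t x = β • eZ := by
  sorry

/-- HEADLINE (assembly, lead): the axis-aware sup-zoom dichotomy of a witness. -/
theorem zoom_dichotomy_of_isMaximalSmoothSolution : ∀ {T : ℝ} {u : ℝ → ℝ³ → ℝ³}
    {p : ℝ → ℝ³ → ℝ}, 0 < T → IsMaximalSmoothSolution 1 0 u p T → IsLerayHopfOn T 1 0 (u 0) u →
    HasRapidSpatialDecay (u 0) → IsAxisymmetric (u 0) →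
    ∃ (t : ℕ → ℝ) (x : ℕ → ℝ³) (W : ℝ → ℝ³ → ℝ³),
      (∀ n, t n ∈ Ioo 0 T) ∧ (∀ n, x n 1 = 0 ∧ 0 ≤ x n 0) ∧
      Tendsto (fun n => ‖u (t n) (x n)‖) atTop atTop ∧
      (∀ n, ∀ s ∈ Ioc 0 (t n), ∀ y, ‖u s y‖ ≤ (1 + 1 / ((n : ℝ) + 1)) * ‖u (t n) (x n)‖) ∧
      ContinuousOn (uncurry W) (Iio 0 ×ˢ univ) ∧ (∀ s < 0, ∀ y, ‖W s y‖ ≤ 1) ∧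
      IsBoundedAncientMildSolution 1 W ∧
      (∃ L : ℝ, ∀ s ∈ Ioo (-1 : ℝ) 0, 1 - L * |s| ≤ ‖W s 0‖) ∧
      (∀ s < 0, TendstoLocallyUniformly
        (fun n (y : ℝ³) => ‖u (t n) (x n)‖⁻¹ •
          u (t n + ‖u (t n) (x n)‖⁻¹ ^ 2 * s) (x n + ‖u (t n) (x n)‖⁻¹ • y)) (W s) atTop) ∧
      ((∃ b : ℝ³, ‖b‖ = 1 ∧ ∀ s < 0, ∀ y, W s y = b) ∨
       (∃ d : ℝ, 0 ≤ d ∧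
          (∀ s < 0, IsAxisymmetric fun y => W s (y - d • EuclideanSpace.single 0 1)) ∧
          (∀ s < 0, ∀ y, |swirl (fun y => W s (y - d • EuclideanSpace.single 0 1)) y| ≤
            ⨆ z, |swirl (u 0) z|) ∧
          ¬ ∀ s < 0, HasNoSwirl fun y => W s (y - d • EuclideanSpace.single 0 1))) := by
  sorry

end Summit.NavierStokesRegularity.NavierStokesRegularity.Theorems.CertifiedBlowupAxisymBlowup.CompactAmplification

end
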